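import Summits.Ventures.PercRepro.ExcessOneNoPartnerPairSetup

/-!
# Theorem (YD), part I: the trace as a complex, the projected differences, and the cone step

Setting (proofs/MINE1-theoremS.md, Addendum 27): `F` has Marica–Schönheim excess one
(`|F \\ F| = |F| + 1`), `{r} ∈ F`, `∅ ∉ F`, the trace `P := proj r F` is tight and contains every
singleton `{a}`, `a ≠ r` (automatic for a twin-free `F` with full support, by Theorem (SD):
`singleton_mem_proj_of_twinFree`). This module collects what the proof of Theorem (YD)
(`ExcessOneDownSet`) needs:

* the bridge `diffs_proj_eq_image_erase` (`D(proj d F) = proj_d D(F)`),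
  `diffs_eq_self_of_tight_of_empty_mem` (a tight family containing `∅` is its own difference
  family), and the complex property of the trace (`mem_proj_of_subset`, `mem_proj_of_mem_diffsY`);
* at a witness direction `b` with `∅ ∉ F`, `{b} ∉ F`: the tight projection `G = proj b F` is closed
  under adding `r` (`insert_r_mem_proj_of_witness`, Lemma B), so `r` lies in its addable part
  (`mem_Rstar_proj_of_witness`);
* **the cone step** `exists_sdiff_eq_of_insert_mem_diffsY`: a set `z ∌ b, r` with `insert b z ∈ Y`
  is the difference `g \ f` of two members `f ⊆ g` of `G` avoiding `r`, with `f` nonempty and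
  disjoint from `z` — Theorem S for `G` (`diffs_eq_flip_of_tight`, `flip_eq_sups_within_of_tight`)
  writes `insert r z = A ∆ Rstar G` with `A ∈ G`, and `g = A ∪ (Rstar G).erase r`,
  `f = A ∩ Rstar G` (the product structure `G₀ = L ⊕ U₀`, `del_b P = L ⊕ 2^A`,
  `D(G₀) = L ⊕ (A − U₀)` of the paper).
-/

namespace PercRepro.MSTight

open Finset
open scoped FinsetFamily symmDiff

variable {α : Type*} [DecidableEq α] [Fintype α]
section Bridge

omit [Fintype α] in
/-- The projection along `d` is the image under `t ↦ t \ {d}`. -/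
theorem proj_eq_image_sdiff_singleton (d : α) (F : Finset (Finset α)) :
    proj d F = F.image fun t => t \ {d} :=
  image_congr fun t _ => (sdiff_singleton_eq_erase d t).symm

omit [Fintype α] in
/-- The differences of the projection along `d` are the projected differences. -/
theorem diffs_proj_eq_image_erase (d : α) (F : Finset (Finset α)) :
    proj d F \\ proj d F = (F \\ F).image fun e => e.erase d := by
  rw [proj_eq_image_sdiff_singleton, diffs_image_sdiff]
  exact image_congr fun e _ => sdiff_singleton_eq_erase d e

omit [Fintype α] in
/-- A tight family containing `∅` is its own difference family. -/
theorem diffs_eq_self_of_tight_of_empty_mem {G : Finset (Finset α)} (hG : Tight G)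
    (h0 : (∅ : Finset α) ∈ G) : G \\ G = G := by
  refine (eq_of_subset_of_card_le (fun g hg => ?_) hG.le).symm
  simpa using sdiff_mem_diffs hg h0

variable {F : Finset (Finset α)} {r : α}

/-- Every singleton `{a}` with `a ≠ r` is a face of the tight trace when `F` is twin-free with full
support: Theorem (SD) gives `{a} ∈ F \\ F`, and `X = P`. -/
theorem singleton_mem_proj_of_twinFree (hF : (F \\ F).card = F.card + 1)
    (hP : Tight (proj r F)) (hr : ({r} : Finset α) ∈ F)
    (htf : ∀ a b, Twin F a b → b = a) (hin : ∀ a, ∃ t ∈ F, a ∈ t) {a : α} (ha : a ≠ r) :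
    ({a} : Finset α) ∈ proj r F := by
  rw [← diffsX_eq_proj_of_singleton_mem hP hr, mem_diffsX_iff]
  refine ⟨singleton_mem_diffs_of_card_diffs_le hF.le (htf a) (hin a) ⟨{r}, hr, ?_⟩, ?_⟩
  · simpa using ha
  · simpa using ha.symm

/-- The tight trace with `{r} ∈ F` and all singletons is a simplicial complex. -/
theorem mem_proj_of_subset (hP : Tight (proj r F)) (hr : ({r} : Finset α) ∈ F)
    (hsing : ∀ a, a ≠ r → ({a} : Finset α) ∈ proj r F) {e : Finset α} (he : e ∈ proj r F)
    {e' : Finset α} (he' : e' ⊆ e) : e' ∈ proj r F := by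
  induction e using Finset.strongInduction with
  | H e ih =>
    by_cases h : e' = e
    · rw [h]; exact he
    · obtain ⟨a, hae, hae'⟩ := exists_of_ssubset (Finset.ssubset_iff_subset_ne.2 ⟨he', h⟩)
      have har : a ≠ r := fun hr' => notMem_of_mem_proj' he (hr' ▸ hae)
      have h1 : e.erase a ∈ proj r F := by
        rw [← sdiff_singleton_eq_erase]
        exact sdiff_mem_proj_of_tight hP hr he (hsing a har)
      exact ih (e.erase a) (erase_ssubset hae) h1 (subset_erase.2 ⟨he', hae'⟩)

/-- Every type-I difference is a face of the trace. -/
theorem mem_proj_of_mem_diffsY (hP : Tight (proj r F)) (hr : ({r} : Finset α) ∈ F)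
    {y : Finset α} (hy : y ∈ diffsY r F) : y ∈ proj r F := by
  obtain ⟨t, ht, s, hs, rfl⟩ := Finset.mem_diffs.1 hy
  have htP : t ∈ proj r F := by rw [proj_eq_union]; exact mem_union_right _ ht
  have hsP : s ∈ proj r F := by rw [proj_eq_union]; exact mem_union_left _ hs
  exact sdiff_mem_proj_of_tight hP hr htP hsP

end Bridge

section DownSet

variable {F : Finset (Finset α)} {r b : α}

/-- At a witness direction `b` with `∅ ∉ F` and `{b} ∉ F`, the tight projection `proj b F` is
closed under adding `r` (Lemma B's first alternative, as in
`mem_partr_or_insert_mem_partr_of_witness`). -/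
theorem insert_r_mem_proj_of_witness (hF : (F \\ F).card = F.card + 1)
    (hP : Tight (proj r F)) (hr : ({r} : Finset α) ∈ F) (hE : (∅ : Finset α) ∉ F)
    (hb0 : ({b} : Finset α) ∉ F) {x : Finset α}
    (hx0 : x ∈ part0 r F) (hbx : b ∉ x) (hxb1 : insert b x ∈ partr r F)
    (hwit : ¬ (x ∈ partr r F ∧ insert b x ∈ part0 r F)) :
    ∀ A ∈ proj b F, r ∉ A → insert r A ∈ proj b F := by
  have hbr : b ≠ r := by
    rintro rfl
    exact (mem_partr.1 hxb1).1 (mem_insert_self b x)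
  have hG : Tight (proj b F) := tight_proj_of_witness hF hP hr hx0 hbx hxb1 hwit
  have hrG : ({r} : Finset α) ∈ proj b F :=
    mem_proj.2 ⟨{r}, hr, by rw [erase_eq_of_notMem]; simpa using hbr⟩
  have hxG : x ∈ partner r (proj b F) := by
    refine mem_inter.2 ⟨mem_part0.2 ⟨?_, (mem_part0.1 hx0).2⟩,
      mem_partr.2 ⟨(mem_part0.1 hx0).2, ?_⟩⟩
    · exact mem_proj.2 ⟨x, (mem_part0.1 hx0).1, erase_eq_of_notMem hbx⟩
    · refine mem_proj.2 ⟨insert b (insert r x), ?_, ?_⟩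
      · rw [Finset.insert_comm]; exact (mem_partr.1 hxb1).2
      · rw [erase_insert]
        rw [mem_insert]; rintro (h | h); exact hbr h; exact hbx h
  have hdich := dichotomy_of_tight (tight_proj_and_partner (r := r) hG).2.1
  have hcard : (part0 r (proj b F)).card ≤ (partr r (proj b F)).card := by
    by_contra hlt
    have hle : (partr r (proj b F)).card ≤ (part0 r (proj b F)).card := by omega
    have h := erase_mem_of_card_le hG ⟨x, hxG⟩ hle hdich {r} hrG (mem_singleton_self r)
    rw [erase_singleton] at h
    obtain ⟨B, hB, hBe⟩ := mem_proj.1 h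
    have : B ⊆ {b} := by
      intro a ha
      rw [mem_singleton]
      by_contra hab
      have : a ∈ B.erase b := mem_erase.2 ⟨hab, ha⟩
      rw [hBe] at this
      exact notMem_empty a this
    rcases subset_singleton_iff.1 this with h1 | h1
    · exact hE (h1 ▸ hB)
    · exact hb0 (h1 ▸ hB)
  exact insert_mem_of_card_le hG ⟨x, hxG⟩ hcard hdich

/-- The twin class of `r` in any family containing `{r}` is `{r}`. -/
theorem cls_eq_singleton_of_singleton_mem {G : Finset (Finset α)} (hrG : ({r} : Finset α) ∈ G) :
    cls G r = {r} :=
  cls_eq_singleton fun _ hy => mem_singleton.1 ((hy {r} hrG).1 (mem_singleton_self r))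

/-- At a witness direction `b` with `∅ ∉ F`, `{b} ∉ F`, the element `r` lies in the addable part of
the tight projection `proj b F`. -/
theorem mem_Rstar_proj_of_witness (hF : (F \\ F).card = F.card + 1)
    (hP : Tight (proj r F)) (hr : ({r} : Finset α) ∈ F) (hE : (∅ : Finset α) ∉ F)
    (hb0 : ({b} : Finset α) ∉ F) {x : Finset α}
    (hx0 : x ∈ part0 r F) (hbx : b ∉ x) (hxb1 : insert b x ∈ partr r F)
    (hwit : ¬ (x ∈ partr r F ∧ insert b x ∈ part0 r F)) : r ∈ Rstar (proj b F) := by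
  have hbr : b ≠ r := by
    rintro rfl
    exact (mem_partr.1 hxb1).1 (mem_insert_self b x)
  have hrG : ({r} : Finset α) ∈ proj b F :=
    mem_proj.2 ⟨{r}, hr, by rw [erase_eq_of_notMem]; simpa using hbr⟩
  rw [mem_Rstar, cls_eq_singleton_of_singleton_mem hrG]
  intro g hg
  by_cases hrg : r ∈ g
  · rw [union_eq_left.2 (singleton_subset_iff.2 hrg)]; exact hg
  · have := insert_r_mem_proj_of_witness hF hP hr hE hb0 hx0 hbx hxb1 hwit g hg hrg
    rwa [union_comm, ← insert_eq]

/-- **The cone step.** At a witness direction `b` (with `∅ ∉ F`, `{b} ∉ F`), a set `z ∌ b, r` with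
`insert b z ∈ Y` is the difference `g \ f` of two members `g ⊇ f` of the tight projection
`G = proj b F` avoiding `r`, with `f` nonempty and disjoint from `z` (so `g ⊋ z`): by Theorem S,
`insert r z = A ∆ Rstar G` for a member `A ∌ r`, and `g = A ∪ (Rstar G).erase r`,
`f = A ∩ Rstar G`. -/
theorem exists_sdiff_eq_of_insert_mem_diffsY (hF : (F \\ F).card = F.card + 1)
    (hP : Tight (proj r F)) (hr : ({r} : Finset α) ∈ F) (hE : (∅ : Finset α) ∉ F)
    (hb0 : ({b} : Finset α) ∉ F) {x : Finset α}
    (hx0 : x ∈ part0 r F) (hbx : b ∉ x) (hxb1 : insert b x ∈ partr r F)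
    (hwit : ¬ (x ∈ partr r F ∧ insert b x ∈ part0 r F))
    {z : Finset α} (hbz : b ∉ z) (hrz : r ∉ z) (hz : insert b z ∈ diffsY r F) :
    ∃ g ∈ proj b F, ∃ f ∈ proj b F, r ∉ g ∧ r ∉ f ∧ f.Nonempty ∧ f ⊆ g ∧ Disjoint f z ∧
      g \ f = z := by
  have hbr : b ≠ r := by
    rintro rfl
    exact (mem_partr.1 hxb1).1 (mem_insert_self b x)
  have hG : Tight (proj b F) := tight_proj_of_witness hF hP hr hx0 hbx hxb1 hwit
  have hrG : ({r} : Finset α) ∈ proj b F :=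
    mem_proj.2 ⟨{r}, hr, by rw [erase_eq_of_notMem]; simpa using hbr⟩
  have hrM : r ∈ Rstar (proj b F) := mem_Rstar_proj_of_witness hF hP hr hE hb0 hx0 hbx hxb1 hwit
  set G := proj b F with hGdef
  set M := Rstar G with hMdef
  -- `insert r z` is a difference of `G`, hence a flipped member
  have hzD : insert r z ∈ G \\ G := by
    have h1 : insert r (insert b z) ∈ F \\ F := (mem_diffsY_iff.1 hz).2
    rw [hGdef, diffs_proj_eq_image_erase]
    refine mem_image.2 ⟨insert r (insert b z), h1, ?_⟩
    rw [erase_insert_of_ne hbr.symm, erase_insert hbz]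
  rw [diffs_eq_flip_of_tight hG] at hzD
  obtain ⟨A, hA, hAz⟩ := mem_flip.1 hzD
  have hrA : r ∉ A := by
    intro hrA
    have : r ∈ A ∆ M := by rw [hAz]; exact mem_insert_self r z
    rw [mem_symmDiff] at this
    rcases this with ⟨_, h⟩ | ⟨_, h⟩
    · exact h hrM
    · exact h hrA
  have hz' : z = (A ∆ M).erase r := by rw [hAz, erase_insert hrz]
  -- `f := A ∩ M` is a member (the product structure of the flip)
  have hAM : A ∆ M ∈ flip M G := symmDiff_mem_flip hA
  rw [flip_eq_sups_within_of_tight hG] at hAM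
  obtain ⟨X, hX, Y', hY', hXY⟩ := mem_sups.1 hAM
  obtain ⟨_, hXN⟩ := mem_within.1 hX
  obtain ⟨hYf, hYM⟩ := mem_within.1 hY'
  have hY'eq : Y' = M \ A := by
    ext a
    constructor
    · intro ha
      have haM : a ∈ M := hYM ha
      have ha' : a ∈ A ∆ M := by rw [← hXY, sup_eq_union]; exact mem_union_right _ ha
      rw [mem_symmDiff] at ha'
      rcases ha' with ⟨_, h⟩ | ⟨_, h⟩
      · exact absurd haM h
      · exact mem_sdiff.2 ⟨haM, h⟩
    · intro ha
      obtain ⟨haM, haA⟩ := mem_sdiff.1 ha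
      have ha' : a ∈ A ∆ M := mem_symmDiff.2 (Or.inr ⟨haM, haA⟩)
      rw [← hXY, sup_eq_union, mem_union] at ha'
      rcases ha' with h | h
      · exact absurd haM (mem_sdiff.1 (hXN h)).2
      · exact h
  have hf : A ∩ M ∈ G := by
    rw [hY'eq] at hYf
    have h := symmDiff_mem_of_mem_flip hYf
    have e : (M \ A) ∆ M = A ∩ M := by
      ext a; simp only [mem_symmDiff, mem_sdiff, mem_inter]; tauto
    rwa [e] at h
  -- `g := A ∪ M.erase r` is a member (adding addable classes)
  have hclsr : cls G r = {r} := cls_eq_singleton_of_singleton_mem hrG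
  have hrtc : TwinClosed G ({r} : Finset α) := by
    have := twinClosed_cls G r
    rwa [hclsr] at this
  have hg : A ∪ M.erase r ∈ G := by
    rw [← sdiff_singleton_eq_erase]
    exact union_mem_of_closedAdd ((twinClosed_Rstar G).sdiff hrtc)
      (fun a ha => mem_Rstar.1 (mem_sdiff.1 ha).1) hA
  refine ⟨A ∪ M.erase r, hg, A ∩ M, hf, ?_, ?_, ?_, ?_, ?_, ?_⟩
  · rw [mem_union, not_or]; exact ⟨hrA, notMem_erase r M⟩
  · exact fun h => hrA (mem_inter.1 h).1
  · rw [nonempty_iff_ne_empty]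
    intro h0
    rw [h0, hGdef] at hf
    obtain ⟨B, hB, hBe⟩ := mem_proj.1 hf
    have : B ⊆ {b} := by
      intro a ha
      rw [mem_singleton]
      by_contra hab
      have : a ∈ B.erase b := mem_erase.2 ⟨hab, ha⟩
      rw [hBe] at this
      exact notMem_empty a this
    rcases subset_singleton_iff.1 this with h1 | h1
    · exact hE (h1 ▸ hB)
    · exact hb0 (h1 ▸ hB)
  · exact inter_subset_left.trans subset_union_left
  · rw [hz', disjoint_left]
    intro a ha ha'
    obtain ⟨haA, haM⟩ := mem_inter.1 ha
    have := (mem_erase.1 ha').2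
    rw [mem_symmDiff] at this
    rcases this with ⟨_, h⟩ | ⟨_, h⟩
    · exact h haM
    · exact h haA
  · rw [hz']
    ext a
    simp only [mem_sdiff, mem_union, mem_erase, mem_inter, mem_symmDiff]
    constructor
    · rintro ⟨h1, h2⟩
      have har : a ≠ r := by
        rintro rfl
        rcases h1 with h | ⟨h, _⟩
        · exact hrA h
        · exact h rfl
      exact ⟨har, by tauto⟩
    · rintro ⟨har, h⟩
      exact ⟨by tauto, by tauto⟩

end DownSet

end PercRepro.MSTight
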